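import Summits.SmoothPoincare4.SmoothPoincare4.Theses.SblfDescent
import Summits.SmoothPoincare4.SmoothPoincare4.Statement
import HarnessLib.Audit.CruxProbe

/-! BC7/BC2 mechanical probe of crux `RungOne` (crux-strategist equivalence audit): P5 `C → S` must NOT close
(`crux.implies-summit` absent), `S → C` is expected to close (shield, informational). -/

#h21_crux_probe Summit.SmoothPoincare4.SmoothPoincare4.Theses.SblfDescent.RungOne route := "route-SmoothPoincare4-SblfDescent"
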